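import Mathlib
import HarnessLib
import Literature.MathematicalPhysics.QuantumFieldTheory.Balaban1983to89.B13Contraction113
import Literature.MathematicalPhysics.QuantumFieldTheory.Balaban1983to89.B12Lineariz267
import Literature.MathematicalPhysics.QuantumFieldTheory.Balaban1983to89.B12LinearizAnalytic267
import Literature.MathematicalPhysics.QuantumFieldTheory.Balaban1983to89.B12JacobianTrLog268

/-!
# B12 [Balaban1987RG1] p. 267 — «D̃(B) has an expansion beginning with quadratic terms, and D̃⁽²⁾(B) = C̃⁽²⁾(B)»:
# the jets of the linearizing function `D̃` at `B = 0` (orders 0 and 1 vanish, order 2 equals that of `C̃`), the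
# chain-rule form of `DD̃`, the third-order remainder `D̃₃ = O(‖B‖³)`, and the scaling limit `g⁻²D̃(gB′) → C̃⁽²⁾(B′)`

CITATION. T. Bałaban, *Renormalization group approach to lattice gauge field theories. I. Generation of effective
actions in a small field approximation and a coupling constant renormalization in four dimensions*, Commun. Math.
Phys. 109 (1987) 249–301 [Balaban1987RG1] ("B12" of the cell), pp. 266–267 (renders
`…1987-cmp109-rg-I-small-field-p018`, `-p019`; PDF page = journal page − 248).  This file sits on top of the tree
leaves `B12Lineariz267` (the substitution `B′ = B − hD̃(B)`, `D̃` BY NAME from the contraction module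
`B13Contraction113`, the bounds `‖D̃(B)‖ ≤ 4C₂‖B‖²`, `‖D̃(B) − C̃(B)‖ ≤ 36C₂²b‖B‖³`), `B12LinearizAnalytic267` (joint
analyticity of `D̃` and of `Φ(B) = B − hD̃(B)`, the strict derivative `DΦ(B) = I − h∘DD̃(B)`) and
`B12JacobianTrLog268` (`DD̃(0) = 0`, `DΦ(0) = 1`); all are imported and used BY NAME, nothing of them is re-derived.

THE PRINT (verbatim).  B12 p. 267 [PDF 19]: *«We are looking for an analytic, 𝐠-valued function D̃(B′), defined at
bonds of T⁽ᵏ⁺¹⁾, and such that the transformation B′ = B − hD̃(B) linearizes the function Q̃(B′). The function D̃(B)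
is determined by the equation LQ̃B′ + C̃(B′) = LQ̃B − D̃(B) + C̃(B − hD̃(B)) = LQ̃B. It is easy to prove, following the
proofs in the above mentioned papers, that there exists exactly one solution of this equation, and that it is an
analytic function of B. From this equation we obtain also that D̃(B) has an expansion beginning with quadratic
terms, and D̃⁽²⁾(B) = C̃⁽²⁾(B).»*  Then: *«Next we make the scaling transformation B = g_kB′.»* … *«Terms of the
order 0 in g_k are ⟨H₁hC̃⁽²⁾(B′), J⟩ − ½G⁽²⁾(B′) − ½⟨H₁B′, Δ₁H₁B′⟩. (2.11)»*.  The notation is fixed on p. 266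
[PDF 18] for the first-step function `D` of [15]: *«we decompose the function D into the sum D⁽²⁾ + D₃, where D⁽²⁾
is the second order term equal to C⁽²⁾, and D₃ is the higher order remainder.»*, and for `G`: *«The function G₃(B′)
is an analytic function of B′, with an expansion beginning with third order terms»*; the remainder `D̃₃` of `D̃` is
what enters (2.12) p. 268 as `(1/g_k²)⟨H₁hD̃₃(g_kCB), J⟩`.  READING: for an analytic `D̃` with `D̃(0) = 0`,
«expansion beginning with quadratic terms» says the jets of orders 0 and 1 of `D̃` at `B = 0` vanish, `D̃⁽²⁾(B)` is
the homogeneous second-order term `½D²D̃(0)(B, B)` of the Taylor expansion at `0`, «D̃⁽²⁾(B) = C̃⁽²⁾(B)» is the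
identity of the second-order terms of `D̃` and `C̃` (both begin at order two: `‖C̃(Y)‖ ≤ C₂‖Y‖²`), which is what
replaces `hD̃⁽²⁾` by `hC̃⁽²⁾` in the order-`g_k⁰` term (2.11) after the scaling `B = g_kB′`
(`g_k⁻²D̃(g_kB′) → D̃⁽²⁾(B′) = C̃⁽²⁾(B′)` as `g_k → 0`), and `D̃₃ := D̃ − D̃⁽²⁾` is of third order.

THE TYPING (schematic, exactly as in the three leaves below this one — cell DIVERGENCE row for this file).  `𝒴`, `𝒳`
complex Banach spaces; `hop : 𝒳 →ₗ[ℂ] 𝒴` (print's `h`) with `‖hop X‖ ≤ b‖X‖`; `Ct : 𝒴 → 𝒳` (print's `C̃`) with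
`B13Contraction113.QuadAnalytic Ct C₂ R` (`‖C̃(Y)‖ ≤ C₂‖Y‖²` on `‖Y‖ < R`) and `AnalyticOnNhd ℂ Ct {‖Y‖ < R}`;
`9C₂bε < 1`, `3ε ≤ R`; `D̃` HYPOTHESIS-STYLE: any `Dt : 𝒴 → 𝒳` with `Dt B ∈ closedBall 0 (4C₂ε²)` and
`Ct (B − hop (Dt B)) = Dt B` on `‖B‖ < ε` (`B12Lineariz267.exists_Dt` / `eq_Dt_of_fixedPt`: this is the print's `D̃`
and nothing else).  The print's `D̃⁽²⁾(B)` is TYPED as `(2:ℂ)⁻¹ • iteratedFDeriv ℂ 2 Dt 0 (fun _ => B)` (equivalently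
the second coefficient `p 2 (fun _ => B)` of ANY power-series expansion `p` of `Dt` at `0`, §3), `C̃⁽²⁾(B)` likewise
with `Ct`, and `D̃₃(B) := Dt B − (2:ℂ)⁻¹ • iteratedFDeriv ℂ 2 Ct 0 (fun _ => B)` (the remainder after the second-order
term, written with `C̃⁽²⁾ = D̃⁽²⁾`).  No definitions are introduced: all objects are written out.

CONTENTS.  §1 [folklore] CALCULUS: (a) a map with `‖C(Y)‖ ≤ C₂‖Y‖²` near `0` has `C(0) = 0` and Fréchet derivative
`0` at `0`; (b) the SECOND-ORDER CHAIN RULE at a point where the outer map is critical and the inner map is tangent to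
the identity: if `g(x₀) = y₀`, `Dg(x₀) = id`, `Df(y₀) = 0` (with the obvious differentiability near the points), then
`D²(f ∘ g)(x₀) = D²f(y₀)` — as `fderiv (fderiv (f ∘ g)) x₀ = fderiv (fderiv f) y₀` and as
`iteratedFDeriv 2 (f ∘ g) x₀ = iteratedFDeriv 2 f y₀` (Mathlib `HasFDerivAt.clm_comp`, `fderiv_comp`, `Filter.EventuallyEq.fderiv`); (c) the
Taylor coefficients of an analytic map are `p n (B, …, B) = (n!)⁻¹ Dⁿf(x)(B, …, B)` (Mathlib
`HasFPowerSeriesOnBall.factorial_smul`).  §2 [folklore] FIRST ORDER: `C̃(0) = 0`, `DC̃(0) = 0`, `D̃(0) = 0`,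
`Φ(0) = 0`, `‖Φ(B)‖ < R` on the ball; `D̃ = C̃ ∘ Φ` near every point of the ball (the print's equation), hence the
CHAIN-RULE FORM of the derivative `DD̃(B₀) = DC̃(Φ(B₀)) ∘ (1 − h∘DD̃(B₀))` («(δ/δB)D̃» differentiated from
`D̃(B) = C̃(B − hD̃(B))`) and its implicit rearrangement `(1 + DC̃(Φ(B₀))∘h) ∘ DD̃(B₀) = DC̃(Φ(B₀))` (consistent with
`B12LinearizAnalytic267.fderiv_Dt`).  §3 [folklore] SECOND ORDER — the print's sentence: `D²D̃(0) = D²C̃(0)` as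
`fderiv ℂ (fderiv ℂ Dt) 0 = fderiv ℂ (fderiv ℂ Ct) 0` and `iteratedFDeriv ℂ 2 Dt 0 = iteratedFDeriv ℂ 2 Ct 0`
(§1 (b) with `f = C̃`, `g = Φ`: `Φ(0) = 0`, `DΦ(0) = 1` by `B12JacobianTrLog268.fderiv_phi_zero`, `DC̃(0) = 0`); the
jets of orders 0 and 1 of `D̃` and of `C̃` at `0` vanish («expansion beginning with quadratic terms»); in
power-series language, for ANY expansions `HasFPowerSeriesAt Dt p 0`, `HasFPowerSeriesAt Ct q 0` (they exist:
`B12LinearizAnalytic267.analyticAt_Dt`, the hypothesis on `C̃`): `p 0 = 0`, `p 1 = 0`, and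
`p 2 (fun _ => B) = q 2 (fun _ => B) = (2:ℂ)⁻¹ • iteratedFDeriv ℂ 2 Ct 0 (fun _ => B)` — «D̃⁽²⁾(B) = C̃⁽²⁾(B)».
§4 [folklore] THIRD ORDER AND SCALING: the remainder `D̃₃(B) = D̃(B) − C̃⁽²⁾(B)` is analytic on `‖B‖ < ε` and
`= O(‖B‖³)` at `B = 0` (Mathlib `HasFPowerSeriesAt.isBigO_sub_partialSum_pow`); `C̃⁽²⁾` is `2`-homogeneous,
`C̃⁽²⁾(gB) = g²C̃⁽²⁾(B)`; and the SCALING LIMIT `g⁻²D̃(gB′) → C̃⁽²⁾(B′)` as `g → 0`, `g ≠ 0` — the mechanism producing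
the `hC̃⁽²⁾(B′)` of the order-zero term (2.11) from `hD̃(g_kCB)`.  §5 a transcription theorem [cite] assembling
§2–§4 for the `D̃` of `B12Lineariz267.p267_linearizing_change_of_variables` / `B12LinearizAnalytic267.p267_analytic_function_of_B`,
and a degenerate model showing the hypotheses are jointly satisfiable.  NOT TYPED: the third-order FORMULA
`D̃⁽³⁾(B) = C̃⁽³⁾(B) − 2C̃⁽²⁾(B, hC̃⁽²⁾(B))` of the template [15] (56) p. 286 (B12 prints only the second-order
identity), an explicit constant in `D̃₃ = O(‖B‖³)` (the print gives none here; the explicit third-order bound of the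
DIFFERENCE `‖D̃(B) − C̃(B)‖ ≤ 36C₂²b‖B‖³` is `B12Lineariz267.norm_Dt_sub_Ct_le`), the pairing `⟨H₁h·, J⟩`, `G⁽²⁾`,
`Δ₁` and the other terms of (2.11)/(2.12), the reality of the jets for real (𝐠-valued) `B`, the lattice formula of
`h`.  Everything is [folklore] calculus except §5; nothing of [B12] is asserted; NOT summit progress.
-/

open Metric Set Filter Topology Asymptotics

namespace Literature.MathematicalPhysics.QuantumFieldTheory.Balaban1983to89.B12SecondOrder267

open Literature.MathematicalPhysics.QuantumFieldTheory.Balaban1983to89.B13Contraction113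
open Literature.MathematicalPhysics.QuantumFieldTheory.Balaban1983to89.B12Lineariz267
open Literature.MathematicalPhysics.QuantumFieldTheory.Balaban1983to89.B12LinearizAnalytic267
open Literature.MathematicalPhysics.QuantumFieldTheory.Balaban1983to89.B12JacobianTrLog268

/-! ## §1  Calculus: quadratic bound ⇒ critical point; the second-order chain rule at a critical ∘ tangent-to-identity
point; Taylor coefficients vs. iterated derivatives -/
section calculus

variable {𝕜 : Type*} [NontriviallyNormedField 𝕜] {E G : Type*} [NormedAddCommGroup E] [NormedSpace 𝕜 E]
  [NormedAddCommGroup G] [NormedSpace 𝕜 G]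

/-- A map with a quadratic bound `‖C(Y)‖ ≤ C₂‖Y‖²` on `‖Y‖ < R` (`0 < R`) vanishes at `0`. [folklore] -/
theorem eq_zero_of_norm_le_sq {C : E → G} {C₂ R : ℝ} (hR : 0 < R)
    (hq : ∀ Y : E, ‖Y‖ < R → ‖C Y‖ ≤ C₂ * ‖Y‖ ^ 2) : C 0 = 0 := by
  have h := hq 0 (by simpa using hR)
  simpa using h

/-- **Quadratic bound ⇒ critical point**: `‖C(Y)‖ ≤ C₂‖Y‖²` on `‖Y‖ < R` gives the Fréchet derivative `DC(0) = 0`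
(directly from the definition: `C(Y) = O(‖Y‖²) = o(Y)`; no analyticity needed). [folklore] -/
theorem hasFDerivAt_zero_of_norm_le_sq {C : E → G} {C₂ R : ℝ} (hR : 0 < R)
    (hq : ∀ Y : E, ‖Y‖ < R → ‖C Y‖ ≤ C₂ * ‖Y‖ ^ 2) : HasFDerivAt C (0 : E →L[𝕜] G) 0 := by
  have h0 : C 0 = 0 := eq_zero_of_norm_le_sq hR hq
  rw [hasFDerivAt_iff_isLittleO_nhds_zero]
  simp only [zero_add, h0, sub_zero, zero_apply]
  have h1 : C =O[𝓝 (0:E)] fun Y : E => ‖Y‖ ^ 2 := by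
    refine IsBigO.of_bound C₂ ?_
    filter_upwards [ball_mem_nhds (0:E) hR] with Y hY
    rw [Real.norm_of_nonneg (by positivity)]
    exact hq Y (mem_ball_zero_iff.mp hY)
  have h2 : (fun Y : E => ‖Y‖ ^ 2) =o[𝓝 (0:E)] fun Y : E => Y := by
    have h := (isLittleO_norm_pow_id (E' := E) one_lt_two)
    simpa using h
  exact h1.trans_isLittleO h2

/-- `fderiv` form of `hasFDerivAt_zero_of_norm_le_sq`. [folklore] -/
theorem fderiv_zero_of_norm_le_sq {C : E → G} {C₂ R : ℝ} (hR : 0 < R)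
    (hq : ∀ Y : E, ‖Y‖ < R → ‖C Y‖ ≤ C₂ * ‖Y‖ ^ 2) : fderiv 𝕜 C 0 = 0 :=
  (hasFDerivAt_zero_of_norm_le_sq (𝕜 := 𝕜) hR hq).fderiv

/-- Derivative of an operator product `y ↦ (c y) ∘ (d y)` at a point where the left factor VANISHES and the right
factor is the IDENTITY: it is the derivative `c'` of the left factor alone (Mathlib `HasFDerivAt.clm_comp` with
`c x = 0`, `d x = id`). [folklore] -/
theorem hasFDerivAt_clm_comp_of_eq_zero_of_eq_id {c : E → E →L[𝕜] G} {c' : E →L[𝕜] E →L[𝕜] G}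
    {d : E → E →L[𝕜] E} {d' : E →L[𝕜] E →L[𝕜] E} {x : E} (hc : HasFDerivAt c c' x) (hd : HasFDerivAt d d' x)
    (hc0 : c x = 0) (hd0 : d x = ContinuousLinearMap.id 𝕜 E) :
    HasFDerivAt (fun y => (c y).comp (d y)) c' x := by
  have h := hc.clm_comp hd
  rw [hc0, hd0, map_zero, ContinuousLinearMap.zero_comp, zero_add] at h
  convert h using 1
  ext v w
  simp

/-- **SECOND-ORDER CHAIN RULE at a critical ∘ tangent-to-identity point.**  Let `g` be differentiable near `x₀`
with `Dg(x₀) = id` and `Dg` differentiable at `x₀`, and `f` differentiable near `y₀ = g(x₀)` with `Df(y₀) = 0` and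
`Df` differentiable at `y₀`.  Then `D²(f ∘ g)(x₀) = D²f(y₀)`: in `D²(f∘g) = D²f(Dg·, Dg·) + Df∘D²g` the second term
dies because `Df(y₀) = 0` and the first is `D²f(y₀)` because `Dg(x₀) = id`. [folklore] -/
theorem fderiv_fderiv_comp_of_critical {f : E → G} {g : E → E} {x₀ : E}
    (hg : ∀ᶠ y in 𝓝 x₀, DifferentiableAt 𝕜 g y) (hf : ∀ᶠ z in 𝓝 (g x₀), DifferentiableAt 𝕜 f z)
    (hf2 : DifferentiableAt 𝕜 (fderiv 𝕜 f) (g x₀)) (hg2 : DifferentiableAt 𝕜 (fderiv 𝕜 g) x₀)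
    (hDf : fderiv 𝕜 f (g x₀) = 0) (hDg : fderiv 𝕜 g x₀ = ContinuousLinearMap.id 𝕜 E) :
    fderiv 𝕜 (fderiv 𝕜 (f ∘ g)) x₀ = fderiv 𝕜 (fderiv 𝕜 f) (g x₀) := by
  have hgx : DifferentiableAt 𝕜 g x₀ := hg.self_of_nhds
  have hf' : ∀ᶠ y in 𝓝 x₀, DifferentiableAt 𝕜 f (g y) := hgx.continuousAt.tendsto.eventually hf
  have heq : fderiv 𝕜 (f ∘ g) =ᶠ[𝓝 x₀] fun y => (fderiv 𝕜 f (g y)).comp (fderiv 𝕜 g y) := by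
    filter_upwards [hg, hf'] with y hgy hfy
    exact fderiv_comp y hfy hgy
  rw [heq.fderiv_eq]
  have hc : HasFDerivAt (fun y => fderiv 𝕜 f (g y)) ((fderiv 𝕜 (fderiv 𝕜 f) (g x₀)).comp (fderiv 𝕜 g x₀)) x₀ :=
    hf2.hasFDerivAt.comp x₀ hgx.hasFDerivAt
  have hd : HasFDerivAt (fun y => fderiv 𝕜 g y) (fderiv 𝕜 (fderiv 𝕜 g) x₀) x₀ := hg2.hasFDerivAt
  rw [(hasFDerivAt_clm_comp_of_eq_zero_of_eq_id hc hd hDf hDg).fderiv, hDg, ContinuousLinearMap.comp_id]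

/-- The same as an identity of second iterated derivatives: `iteratedFDeriv 2 (f ∘ g) x₀ = iteratedFDeriv 2 f (g x₀)`.
[folklore] -/
theorem iteratedFDeriv_two_comp_of_critical {f : E → G} {g : E → E} {x₀ : E}
    (hg : ∀ᶠ y in 𝓝 x₀, DifferentiableAt 𝕜 g y) (hf : ∀ᶠ z in 𝓝 (g x₀), DifferentiableAt 𝕜 f z)
    (hf2 : DifferentiableAt 𝕜 (fderiv 𝕜 f) (g x₀)) (hg2 : DifferentiableAt 𝕜 (fderiv 𝕜 g) x₀)
    (hDf : fderiv 𝕜 f (g x₀) = 0) (hDg : fderiv 𝕜 g x₀ = ContinuousLinearMap.id 𝕜 E) :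
    iteratedFDeriv 𝕜 2 (f ∘ g) x₀ = iteratedFDeriv 𝕜 2 f (g x₀) := by
  ext m
  simp only [iteratedFDeriv_two_apply, fderiv_fderiv_comp_of_critical hg hf hf2 hg2 hDf hDg]

/-- The zeroth Taylor coefficient is `f x`; it vanishes when `f x = 0` … [folklore] -/
theorem coeff_zero_eq_zero {f : E → G} {p : FormalMultilinearSeries 𝕜 E G} {x : E}
    (hp : HasFPowerSeriesAt f p x) (hf : f x = 0) : p 0 = 0 := by
  ext v
  rw [hp.coeff_zero v, hf]
  simp

/-- … and the first Taylor coefficient is `Df(x)`; it vanishes when `Df(x) = 0`. [folklore] -/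
theorem coeff_one_eq_zero {f : E → G} {p : FormalMultilinearSeries 𝕜 E G} {x : E}
    (hp : HasFPowerSeriesAt f p x) (hf : fderiv 𝕜 f x = 0) : p 1 = 0 := by
  ext m
  have h1 : p 1 m = fderiv 𝕜 f x (m 0) := by
    rw [hp.fderiv_eq]
    simp only [continuousMultilinearCurryFin1_apply]
    congr 1
    ext i
    fin_cases i
    rfl
  rw [h1, hf]
  simp

variable [CompleteSpace G]

/-- **Taylor coefficients vs. iterated derivatives** (over `ℂ`, or any complete field of characteristic zero): for
an analytic `f` with expansion `p` at `x`, `p n (B, …, B) = (n!)⁻¹ • Dⁿf(x)(B, …, B)` (Mathlib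
`HasFPowerSeriesOnBall.factorial_smul`). [folklore] -/
theorem coeff_diag_eq_inv_factorial_smul [CharZero 𝕜] {f : E → G} {p : FormalMultilinearSeries 𝕜 E G} {x : E}
    (hp : HasFPowerSeriesAt f p x) (n : ℕ) (B : E) :
    p n (fun _ => B) = ((n.factorial : 𝕜)⁻¹) • iteratedFDeriv 𝕜 n f x (fun _ => B) := by
  obtain ⟨r, hr⟩ := hp
  have h := hr.factorial_smul B n
  rw [← h, ← Nat.cast_smul_eq_nsmul 𝕜, smul_smul, inv_mul_cancel₀ (by exact_mod_cast (Nat.factorial_ne_zero n)),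
    one_smul]

end calculus

/-! ## §2  First order: `C̃(0) = 0`, `DC̃(0) = 0`, `D̃(0) = 0`, `Φ(0) = 0`; `D̃ = C̃ ∘ Φ` near every point of the ball and
the chain-rule form of `DD̃` -/
section firstorder

variable {𝒳 𝒴 : Type*} [NormedAddCommGroup 𝒳] [NormedSpace ℂ 𝒳] [CompleteSpace 𝒳]
  [NormedAddCommGroup 𝒴] [NormedSpace ℂ 𝒴] [CompleteSpace 𝒴]
  {hop : 𝒳 →ₗ[ℂ] 𝒴} {Ct : 𝒴 → 𝒳} {C₂ R b ε : ℝ} {Dt : 𝒴 → 𝒳}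

omit [CompleteSpace 𝒳] [CompleteSpace 𝒴] in
/-- `C̃(0) = 0` (from `‖C̃(Y)‖ ≤ C₂‖Y‖²`). [folklore] -/
theorem Ct_zero (hC : QuadAnalytic Ct C₂ R) (hR : 0 < R) : Ct (0:𝒴) = 0 :=
  eq_zero_of_norm_le_sq hR hC.quad

omit [CompleteSpace 𝒳] [CompleteSpace 𝒴] in
/-- **`DC̃(0) = 0`**: `C̃` is critical at the origin — «C̃⁽²⁾» is its leading term. [folklore] -/
theorem hasFDerivAt_Ct_zero (hC : QuadAnalytic Ct C₂ R) (hR : 0 < R) : HasFDerivAt Ct (0 : 𝒴 →L[ℂ] 𝒳) 0 :=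
  hasFDerivAt_zero_of_norm_le_sq hR hC.quad

omit [CompleteSpace 𝒳] [CompleteSpace 𝒴] in
/-- `fderiv ℂ C̃ 0 = 0`. [folklore] -/
theorem fderiv_Ct_zero (hC : QuadAnalytic Ct C₂ R) (hR : 0 < R) : fderiv ℂ Ct (0:𝒴) = 0 :=
  (hasFDerivAt_Ct_zero hC hR).fderiv

omit [CompleteSpace 𝒴] in
/-- `D̃(0) = 0` (from `‖D̃(B)‖ ≤ 4C₂‖B‖²`, `B12Lineariz267.norm_Dt_le`). [folklore] -/
theorem Dt_zero (hC : QuadAnalytic Ct C₂ R) (hC₂ : 0 ≤ C₂) (hb : 0 ≤ b) (hHop : ∀ X, ‖hop X‖ ≤ b * ‖X‖)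
    (hq : 9 * C₂ * b * ε < 1) (hRC : 3 * ε ≤ R)
    (hDball : ∀ B : 𝒴, ‖B‖ < ε → Dt B ∈ closedBall (0:𝒳) (4 * C₂ * ε ^ 2))
    (hDfix : ∀ B : 𝒴, ‖B‖ < ε → Ct (B - hop (Dt B)) = Dt B) (hε : 0 < ε) : Dt (0:𝒴) = 0 := by
  have h := norm_Dt_le hC hC₂ hb hHop hq hRC hDball hDfix (B := (0:𝒴)) (by simpa using hε)
  simpa using h

omit [CompleteSpace 𝒴] in
/-- `Φ(0) = 0 − hD̃(0) = 0`. [folklore] -/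
theorem phi_zero (hC : QuadAnalytic Ct C₂ R) (hC₂ : 0 ≤ C₂) (hb : 0 ≤ b) (hHop : ∀ X, ‖hop X‖ ≤ b * ‖X‖)
    (hq : 9 * C₂ * b * ε < 1) (hRC : 3 * ε ≤ R)
    (hDball : ∀ B : 𝒴, ‖B‖ < ε → Dt B ∈ closedBall (0:𝒳) (4 * C₂ * ε ^ 2))
    (hDfix : ∀ B : 𝒴, ‖B‖ < ε → Ct (B - hop (Dt B)) = Dt B) (hε : 0 < ε) :
    (fun B => B - hop (Dt B)) (0:𝒴) = 0 := by
  simp [Dt_zero hC hC₂ hb hHop hq hRC hDball hDfix hε]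

omit [CompleteSpace 𝒴] in
/-- `‖Φ(B₀)‖ < R` for `‖B₀‖ < ε` (`‖Φ(B₀)‖ < 2ε`, `B12Lineariz267.mapsTo_phi`, and `3ε ≤ R`): `Φ` maps the ball into
the analyticity domain of `C̃`. [folklore] -/
theorem norm_phi_lt (hC : QuadAnalytic Ct C₂ R) (hC₂ : 0 ≤ C₂) (hb : 0 ≤ b) (hHop : ∀ X, ‖hop X‖ ≤ b * ‖X‖)
    (hq : 9 * C₂ * b * ε < 1) (hRC : 3 * ε ≤ R)
    (hDball : ∀ B : 𝒴, ‖B‖ < ε → Dt B ∈ closedBall (0:𝒳) (4 * C₂ * ε ^ 2))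
    (hDfix : ∀ B : 𝒴, ‖B‖ < ε → Ct (B - hop (Dt B)) = Dt B) {B₀ : 𝒴} (hB₀ : ‖B₀‖ < ε) :
    ‖B₀ - hop (Dt B₀)‖ < R := by
  have hε : 0 < ε := lt_of_le_of_lt (norm_nonneg _) hB₀
  have h := mapsTo_phi hC hC₂ hb hHop hq hRC hDball hDfix (mem_ball_zero_iff.mpr hB₀)
  rw [mem_ball_zero_iff] at h
  linarith

omit [CompleteSpace 𝒳] [CompleteSpace 𝒴] in
/-- **The print's equation near every point**: `D̃ = C̃ ∘ Φ` eventually near each `‖B₀‖ < ε` (the ball is open).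
[folklore] -/
theorem Dt_eventuallyEq (hDfix : ∀ B : 𝒴, ‖B‖ < ε → Ct (B - hop (Dt B)) = Dt B) {B₀ : 𝒴} (hB₀ : ‖B₀‖ < ε) :
    Dt =ᶠ[𝓝 B₀] (Ct ∘ fun B => B - hop (Dt B)) := by
  filter_upwards [isOpen_ball.mem_nhds (mem_ball_zero_iff.mpr hB₀)] with B hB
  exact (hDfix B (mem_ball_zero_iff.mp hB)).symm

/-- **CHAIN-RULE FORM of the derivative**: `DD̃(B₀) = DC̃(Φ(B₀)) ∘ DΦ(B₀) = DC̃(Φ(B₀)) ∘ (1 − h∘DD̃(B₀))` —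
differentiating `D̃(B) = C̃(B − hD̃(B))`. [folklore] -/
theorem hasFDerivAt_Dt_chain (hC : QuadAnalytic Ct C₂ R) (hCa : AnalyticOnNhd ℂ Ct {Y : 𝒴 | ‖Y‖ < R})
    (hC₂ : 0 ≤ C₂) (hb : 0 ≤ b) (hHop : ∀ X, ‖hop X‖ ≤ b * ‖X‖) (hq : 9 * C₂ * b * ε < 1)
    (hRC : 3 * ε ≤ R) (hDball : ∀ B : 𝒴, ‖B‖ < ε → Dt B ∈ closedBall (0:𝒳) (4 * C₂ * ε ^ 2))
    (hDfix : ∀ B : 𝒴, ‖B‖ < ε → Ct (B - hop (Dt B)) = Dt B) {B₀ : 𝒴} (hB₀ : ‖B₀‖ < ε) :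
    HasFDerivAt Dt (fderiv ℂ Ct (B₀ - hop (Dt B₀)) ∘L (1 - hop.mkContinuous b hHop ∘L fderiv ℂ Dt B₀)) B₀ := by
  have hCt : HasFDerivAt Ct (fderiv ℂ Ct (B₀ - hop (Dt B₀))) (B₀ - hop (Dt B₀)) :=
    (hCa _ (norm_phi_lt hC hC₂ hb hHop hq hRC hDball hDfix hB₀)).differentiableAt.hasFDerivAt
  have hΦ := (hasStrictFDerivAt_phi hC hCa hC₂ hb hHop hq hRC hDball hDfix hB₀).hasFDerivAt
  have h := (hCt.comp B₀ hΦ).congr_of_eventuallyEq (Dt_eventuallyEq hDfix hB₀)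
  rwa [← ContinuousLinearMap.one_def] at h

/-- `fderiv` form: `fderiv ℂ Dt B₀ = fderiv ℂ Ct (Φ B₀) ∘L (1 − J(B₀))`. [folklore] -/
theorem fderiv_Dt_chain (hC : QuadAnalytic Ct C₂ R) (hCa : AnalyticOnNhd ℂ Ct {Y : 𝒴 | ‖Y‖ < R})
    (hC₂ : 0 ≤ C₂) (hb : 0 ≤ b) (hHop : ∀ X, ‖hop X‖ ≤ b * ‖X‖) (hq : 9 * C₂ * b * ε < 1)
    (hRC : 3 * ε ≤ R) (hDball : ∀ B : 𝒴, ‖B‖ < ε → Dt B ∈ closedBall (0:𝒳) (4 * C₂ * ε ^ 2))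
    (hDfix : ∀ B : 𝒴, ‖B‖ < ε → Ct (B - hop (Dt B)) = Dt B) {B₀ : 𝒴} (hB₀ : ‖B₀‖ < ε) :
    fderiv ℂ Dt B₀ = fderiv ℂ Ct (B₀ - hop (Dt B₀)) ∘L (1 - hop.mkContinuous b hHop ∘L fderiv ℂ Dt B₀) :=
  (hasFDerivAt_Dt_chain hC hCa hC₂ hb hHop hq hRC hDball hDfix hB₀).fderiv

/-- **Implicit rearrangement**: `(1 + DC̃(Φ(B₀))∘h) ∘ DD̃(B₀) = DC̃(Φ(B₀))` — the linear equation solved by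
`B12LinearizAnalytic267.fderiv_Dt` (`DD̃ = (1 + DC̃h)⁻¹DC̃`). [folklore] -/
theorem fderiv_Dt_implicit (hC : QuadAnalytic Ct C₂ R) (hCa : AnalyticOnNhd ℂ Ct {Y : 𝒴 | ‖Y‖ < R})
    (hC₂ : 0 ≤ C₂) (hb : 0 ≤ b) (hHop : ∀ X, ‖hop X‖ ≤ b * ‖X‖) (hq : 9 * C₂ * b * ε < 1)
    (hRC : 3 * ε ≤ R) (hDball : ∀ B : 𝒴, ‖B‖ < ε → Dt B ∈ closedBall (0:𝒳) (4 * C₂ * ε ^ 2))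
    (hDfix : ∀ B : 𝒴, ‖B‖ < ε → Ct (B - hop (Dt B)) = Dt B) {B₀ : 𝒴} (hB₀ : ‖B₀‖ < ε) :
    (1 + fderiv ℂ Ct (B₀ - hop (Dt B₀)) ∘L hop.mkContinuous b hHop) ∘L fderiv ℂ Dt B₀ =
      fderiv ℂ Ct (B₀ - hop (Dt B₀)) := by
  have h := fderiv_Dt_chain hC hCa hC₂ hb hHop hq hRC hDball hDfix hB₀
  set D := fderiv ℂ Ct (B₀ - hop (Dt B₀))
  set K := hop.mkContinuous b hHop
  set X := fderiv ℂ Dt B₀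
  have h' : X = D - D ∘L (K ∘L X) := by
    conv_lhs => rw [h]
    rw [ContinuousLinearMap.comp_sub, ContinuousLinearMap.one_def, ContinuousLinearMap.comp_id]
  rw [ContinuousLinearMap.add_comp, ContinuousLinearMap.one_def, ContinuousLinearMap.id_comp,
    ContinuousLinearMap.comp_assoc]
  exact eq_sub_iff_add_eq.mp h'

end firstorder

/-! ## §3  Second order: `D²D̃(0) = D²C̃(0)` — «D̃⁽²⁾(B) = C̃⁽²⁾(B)» — and the vanishing of the jets of orders 0, 1 -/
section secondorder

variable {𝒳 𝒴 : Type*} [NormedAddCommGroup 𝒳] [NormedSpace ℂ 𝒳] [CompleteSpace 𝒳]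
  [NormedAddCommGroup 𝒴] [NormedSpace ℂ 𝒴] [CompleteSpace 𝒴]
  {hop : 𝒳 →ₗ[ℂ] 𝒴} {Ct : 𝒴 → 𝒳} {C₂ R b ε : ℝ} {Dt : 𝒴 → 𝒳}

/-- **`D²D̃(0) = D²C̃(0)`** as `fderiv ℂ (fderiv ℂ Dt) 0 = fderiv ℂ (fderiv ℂ Ct) 0`: the second-order chain rule
(§1) for `D̃ = C̃ ∘ Φ` at `B = 0`, where `Φ(0) = 0`, `DΦ(0) = 1` (`B12JacobianTrLog268.fderiv_phi_zero`) and
`DC̃(0) = 0`. [folklore] -/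
theorem fderiv_fderiv_Dt_zero (hC : QuadAnalytic Ct C₂ R) (hCa : AnalyticOnNhd ℂ Ct {Y : 𝒴 | ‖Y‖ < R})
    (hC₂ : 0 ≤ C₂) (hb : 0 ≤ b) (hHop : ∀ X, ‖hop X‖ ≤ b * ‖X‖) (hq : 9 * C₂ * b * ε < 1)
    (hRC : 3 * ε ≤ R) (hDball : ∀ B : 𝒴, ‖B‖ < ε → Dt B ∈ closedBall (0:𝒳) (4 * C₂ * ε ^ 2))
    (hDfix : ∀ B : 𝒴, ‖B‖ < ε → Ct (B - hop (Dt B)) = Dt B) (hε : 0 < ε) :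
    fderiv ℂ (fderiv ℂ Dt) (0:𝒴) = fderiv ℂ (fderiv ℂ Ct) 0 := by
  have hR : 0 < R := by linarith
  have h0 : ‖(0:𝒴)‖ < ε := by simpa using hε
  have hΦ0 : (fun B => B - hop (Dt B)) (0:𝒴) = 0 := phi_zero hC hC₂ hb hHop hq hRC hDball hDfix hε
  -- `fderiv D̃ = fderiv (C̃ ∘ Φ)` near `0`
  have h1 : fderiv ℂ Dt =ᶠ[𝓝 (0:𝒴)] fderiv ℂ (Ct ∘ fun B => B - hop (Dt B)) :=
    (Dt_eventuallyEq hDfix h0).fderiv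
  rw [h1.fderiv_eq]
  have hΦa := analyticOnNhd_phi hC hCa hC₂ hb hHop hq hRC hDball hDfix
  have hball : ball (0:𝒴) ε ∈ 𝓝 (0:𝒴) := ball_mem_nhds _ hε
  have hg : ∀ᶠ y in 𝓝 (0:𝒴), DifferentiableAt ℂ (fun B => B - hop (Dt B)) y := by
    filter_upwards [hball] with y hy using (hΦa y hy).differentiableAt
  have hRball : {Y : 𝒴 | ‖Y‖ < R} ∈ 𝓝 ((fun B => B - hop (Dt B)) (0:𝒴)) := by
    rw [hΦ0]
    exact (isOpen_lt continuous_norm continuous_const).mem_nhds (by simpa using hR)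
  have hf : ∀ᶠ z in 𝓝 ((fun B => B - hop (Dt B)) (0:𝒴)), DifferentiableAt ℂ Ct z := by
    filter_upwards [hRball] with z hz using (hCa z hz).differentiableAt
  have hf2 : DifferentiableAt ℂ (fderiv ℂ Ct) ((fun B => B - hop (Dt B)) (0:𝒴)) := by
    rw [hΦ0]; exact (hCa.fderiv 0 (by simpa using hR)).differentiableAt
  have hg2 : DifferentiableAt ℂ (fderiv ℂ (fun B => B - hop (Dt B))) (0:𝒴) :=
    (hΦa.fderiv 0 (mem_ball_self hε)).differentiableAt
  have hDf : fderiv ℂ Ct ((fun B => B - hop (Dt B)) (0:𝒴)) = 0 := by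
    rw [hΦ0]; exact fderiv_Ct_zero hC hR
  have hDg : fderiv ℂ (fun B => B - hop (Dt B)) (0:𝒴) = ContinuousLinearMap.id ℂ 𝒴 := by
    rw [fderiv_phi_zero hC hCa hC₂ hb hHop hq hRC hDball hDfix hε, ContinuousLinearMap.one_def]
  have hΦ0' : (0:𝒴) - hop (Dt 0) = 0 := by simpa using hΦ0
  rw [fderiv_fderiv_comp_of_critical hg hf hf2 hg2 hDf hDg]
  exact congrArg _ hΦ0'

/-- **«D̃⁽²⁾(B) = C̃⁽²⁾(B)»** as the identity of second iterated Fréchet derivatives at the origin: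
`iteratedFDeriv ℂ 2 Dt 0 = iteratedFDeriv ℂ 2 Ct 0`. [cite: Balaban1987RG1, p.267] -/
theorem iteratedFDeriv_two_Dt_zero (hC : QuadAnalytic Ct C₂ R) (hCa : AnalyticOnNhd ℂ Ct {Y : 𝒴 | ‖Y‖ < R})
    (hC₂ : 0 ≤ C₂) (hb : 0 ≤ b) (hHop : ∀ X, ‖hop X‖ ≤ b * ‖X‖) (hq : 9 * C₂ * b * ε < 1)
    (hRC : 3 * ε ≤ R) (hDball : ∀ B : 𝒴, ‖B‖ < ε → Dt B ∈ closedBall (0:𝒳) (4 * C₂ * ε ^ 2))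
    (hDfix : ∀ B : 𝒴, ‖B‖ < ε → Ct (B - hop (Dt B)) = Dt B) (hε : 0 < ε) :
    iteratedFDeriv ℂ 2 Dt (0:𝒴) = iteratedFDeriv ℂ 2 Ct 0 := by
  ext m
  simp only [iteratedFDeriv_two_apply, fderiv_fderiv_Dt_zero hC hCa hC₂ hb hHop hq hRC hDball hDfix hε]

omit [CompleteSpace 𝒴] in
/-- «expansion beginning with quadratic terms», order 0: `iteratedFDeriv ℂ 0 Dt 0 = 0`. [folklore] -/
theorem iteratedFDeriv_zero_Dt_zero (hC : QuadAnalytic Ct C₂ R) (hC₂ : 0 ≤ C₂) (hb : 0 ≤ b)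
    (hHop : ∀ X, ‖hop X‖ ≤ b * ‖X‖) (hq : 9 * C₂ * b * ε < 1) (hRC : 3 * ε ≤ R)
    (hDball : ∀ B : 𝒴, ‖B‖ < ε → Dt B ∈ closedBall (0:𝒳) (4 * C₂ * ε ^ 2))
    (hDfix : ∀ B : 𝒴, ‖B‖ < ε → Ct (B - hop (Dt B)) = Dt B) (hε : 0 < ε) :
    iteratedFDeriv ℂ 0 Dt (0:𝒴) = 0 := by
  ext m
  rw [iteratedFDeriv_zero_apply, Dt_zero hC hC₂ hb hHop hq hRC hDball hDfix hε]
  simp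

/-- «expansion beginning with quadratic terms», order 1: `iteratedFDeriv ℂ 1 Dt 0 = 0`
(`B12JacobianTrLog268.fderiv_Dt_zero`). [folklore] -/
theorem iteratedFDeriv_one_Dt_zero (hC : QuadAnalytic Ct C₂ R) (hCa : AnalyticOnNhd ℂ Ct {Y : 𝒴 | ‖Y‖ < R})
    (hC₂ : 0 ≤ C₂) (hb : 0 ≤ b) (hHop : ∀ X, ‖hop X‖ ≤ b * ‖X‖) (hq : 9 * C₂ * b * ε < 1)
    (hRC : 3 * ε ≤ R) (hDball : ∀ B : 𝒴, ‖B‖ < ε → Dt B ∈ closedBall (0:𝒳) (4 * C₂ * ε ^ 2))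
    (hDfix : ∀ B : 𝒴, ‖B‖ < ε → Ct (B - hop (Dt B)) = Dt B) (hε : 0 < ε) :
    iteratedFDeriv ℂ 1 Dt (0:𝒴) = 0 := by
  ext m
  rw [iteratedFDeriv_one_apply, fderiv_Dt_zero hC hCa hC₂ hb hHop hq hRC hDball hDfix hε]
  simp

omit [CompleteSpace 𝒳] [CompleteSpace 𝒴] in
/-- The same two vanishings for `C̃`: `iteratedFDeriv ℂ 0 Ct 0 = 0`. [folklore] -/
theorem iteratedFDeriv_zero_Ct_zero (hC : QuadAnalytic Ct C₂ R) (hR : 0 < R) :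
    iteratedFDeriv ℂ 0 Ct (0:𝒴) = 0 := by
  ext m
  rw [iteratedFDeriv_zero_apply, Ct_zero hC hR]
  simp

omit [CompleteSpace 𝒳] [CompleteSpace 𝒴] in
/-- `iteratedFDeriv ℂ 1 Ct 0 = 0`. [folklore] -/
theorem iteratedFDeriv_one_Ct_zero (hC : QuadAnalytic Ct C₂ R) (hR : 0 < R) :
    iteratedFDeriv ℂ 1 Ct (0:𝒴) = 0 := by
  ext m
  rw [iteratedFDeriv_one_apply, fderiv_Ct_zero hC hR]
  simp

/-- **Power-series form, orders 0 and 1**: for ANY expansion `p` of `D̃` at `0`, `p 0 = 0` and `p 1 = 0`. [folklore] -/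
theorem coeff_zero_one_Dt (hC : QuadAnalytic Ct C₂ R) (hCa : AnalyticOnNhd ℂ Ct {Y : 𝒴 | ‖Y‖ < R})
    (hC₂ : 0 ≤ C₂) (hb : 0 ≤ b) (hHop : ∀ X, ‖hop X‖ ≤ b * ‖X‖) (hq : 9 * C₂ * b * ε < 1)
    (hRC : 3 * ε ≤ R) (hDball : ∀ B : 𝒴, ‖B‖ < ε → Dt B ∈ closedBall (0:𝒳) (4 * C₂ * ε ^ 2))
    (hDfix : ∀ B : 𝒴, ‖B‖ < ε → Ct (B - hop (Dt B)) = Dt B) (hε : 0 < ε)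
    {p : FormalMultilinearSeries ℂ 𝒴 𝒳} (hp : HasFPowerSeriesAt Dt p 0) : p 0 = 0 ∧ p 1 = 0 :=
  ⟨coeff_zero_eq_zero hp (Dt_zero hC hC₂ hb hHop hq hRC hDball hDfix hε),
    coeff_one_eq_zero hp (fderiv_Dt_zero hC hCa hC₂ hb hHop hq hRC hDball hDfix hε)⟩

omit [CompleteSpace 𝒳] [CompleteSpace 𝒴] in
/-- … and for ANY expansion `q` of `C̃` at `0`, `q 0 = 0` and `q 1 = 0`. [folklore] -/
theorem coeff_zero_one_Ct (hC : QuadAnalytic Ct C₂ R) (hR : 0 < R)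
    {q : FormalMultilinearSeries ℂ 𝒴 𝒳} (hq' : HasFPowerSeriesAt Ct q 0) : q 0 = 0 ∧ q 1 = 0 :=
  ⟨coeff_zero_eq_zero hq' (Ct_zero hC hR), coeff_one_eq_zero hq' (fderiv_Ct_zero hC hR)⟩

/-- **«D̃⁽²⁾(B) = C̃⁽²⁾(B)» in power-series language**: the homogeneous second-order terms of ANY expansions of `D̃`
and `C̃` at `0` coincide, `p 2 (B, B) = q 2 (B, B)` (both equal `½D²C̃(0)(B, B)`). [cite: Balaban1987RG1, p.267] -/
theorem coeff_two_Dt_eq_Ct (hC : QuadAnalytic Ct C₂ R) (hCa : AnalyticOnNhd ℂ Ct {Y : 𝒴 | ‖Y‖ < R})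
    (hC₂ : 0 ≤ C₂) (hb : 0 ≤ b) (hHop : ∀ X, ‖hop X‖ ≤ b * ‖X‖) (hq : 9 * C₂ * b * ε < 1)
    (hRC : 3 * ε ≤ R) (hDball : ∀ B : 𝒴, ‖B‖ < ε → Dt B ∈ closedBall (0:𝒳) (4 * C₂ * ε ^ 2))
    (hDfix : ∀ B : 𝒴, ‖B‖ < ε → Ct (B - hop (Dt B)) = Dt B) (hε : 0 < ε)
    {p q : FormalMultilinearSeries ℂ 𝒴 𝒳} (hp : HasFPowerSeriesAt Dt p 0) (hq' : HasFPowerSeriesAt Ct q 0)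
    (B : 𝒴) : p 2 (fun _ => B) = q 2 (fun _ => B) := by
  rw [coeff_diag_eq_inv_factorial_smul hp, coeff_diag_eq_inv_factorial_smul hq',
    iteratedFDeriv_two_Dt_zero hC hCa hC₂ hb hHop hq hRC hDball hDfix hε]

/-- The second-order term of `D̃` written with `C̃`: `p 2 (B, B) = (2:ℂ)⁻¹ • D²C̃(0)(B, B)`. [folklore] -/
theorem coeff_two_Dt_eq (hC : QuadAnalytic Ct C₂ R) (hCa : AnalyticOnNhd ℂ Ct {Y : 𝒴 | ‖Y‖ < R})
    (hC₂ : 0 ≤ C₂) (hb : 0 ≤ b) (hHop : ∀ X, ‖hop X‖ ≤ b * ‖X‖) (hq : 9 * C₂ * b * ε < 1)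
    (hRC : 3 * ε ≤ R) (hDball : ∀ B : 𝒴, ‖B‖ < ε → Dt B ∈ closedBall (0:𝒳) (4 * C₂ * ε ^ 2))
    (hDfix : ∀ B : 𝒴, ‖B‖ < ε → Ct (B - hop (Dt B)) = Dt B) (hε : 0 < ε)
    {p : FormalMultilinearSeries ℂ 𝒴 𝒳} (hp : HasFPowerSeriesAt Dt p 0) (B : 𝒴) :
    p 2 (fun _ => B) = (2:ℂ)⁻¹ • iteratedFDeriv ℂ 2 Ct 0 (fun _ => B) := by
  rw [coeff_diag_eq_inv_factorial_smul hp, iteratedFDeriv_two_Dt_zero hC hCa hC₂ hb hHop hq hRC hDball hDfix hε]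
  norm_num

end secondorder

/-! ## §4  Third order and scaling: `D̃₃ = D̃ − C̃⁽²⁾ = O(‖B‖³)`, analytic; `C̃⁽²⁾(gB) = g²C̃⁽²⁾(B)`;
`g⁻²D̃(gB′) → C̃⁽²⁾(B′)` -/
section thirdorder

variable {𝒳 𝒴 : Type*} [NormedAddCommGroup 𝒳] [NormedSpace ℂ 𝒳] [CompleteSpace 𝒳]
  [NormedAddCommGroup 𝒴] [NormedSpace ℂ 𝒴] [CompleteSpace 𝒴]
  {hop : 𝒳 →ₗ[ℂ] 𝒴} {Ct : 𝒴 → 𝒳} {C₂ R b ε : ℝ} {Dt : 𝒴 → 𝒳}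

omit [CompleteSpace 𝒳] [CompleteSpace 𝒴] in
/-- `C̃⁽²⁾` is `2`-homogeneous: `D²C̃(0)(gB, gB) = g² D²C̃(0)(B, B)` (bilinearity). [folklore] -/
theorem iteratedFDeriv_two_smul (f : 𝒴 → 𝒳) (x : 𝒴) (g : ℂ) (B : 𝒴) :
    iteratedFDeriv ℂ 2 f x (fun _ => g • B) = g ^ 2 • iteratedFDeriv ℂ 2 f x (fun _ => B) := by
  rw [show (fun _ : Fin 2 => g • B) = fun i : Fin 2 => (fun _ : Fin 2 => g) i • (fun _ : Fin 2 => B) i from rfl,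
    ContinuousMultilinearMap.map_smul_univ]
  simp

omit [CompleteSpace 𝒳] [CompleteSpace 𝒴] in
/-- The homogeneous quadratic map `B ↦ D²C̃(0)(B, B)` is analytic everywhere (a continuous bilinear map on the
diagonal). [folklore] -/
theorem analyticAt_iteratedFDeriv_two_diag (f : 𝒴 → 𝒳) (x B₀ : 𝒴) :
    AnalyticAt ℂ (fun B : 𝒴 => iteratedFDeriv ℂ 2 f x (fun _ => B)) B₀ := by
  have hL : AnalyticAt ℂ (fun B : 𝒴 => (fun _ : Fin 2 => B)) B₀ :=
    (ContinuousLinearMap.pi fun _ : Fin 2 => ContinuousLinearMap.id ℂ 𝒴).analyticAt B₀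
  exact (ContinuousMultilinearMap.analyticAt (iteratedFDeriv ℂ 2 f x)).comp hL

/-- **The remainder `D̃₃ = D̃ − C̃⁽²⁾` is analytic on `‖B‖ < ε`.** [folklore] -/
theorem analyticOnNhd_Dt3 (hC : QuadAnalytic Ct C₂ R) (hCa : AnalyticOnNhd ℂ Ct {Y : 𝒴 | ‖Y‖ < R})
    (hC₂ : 0 ≤ C₂) (hb : 0 ≤ b) (hHop : ∀ X, ‖hop X‖ ≤ b * ‖X‖) (hq : 9 * C₂ * b * ε < 1)
    (hRC : 3 * ε ≤ R) (hDball : ∀ B : 𝒴, ‖B‖ < ε → Dt B ∈ closedBall (0:𝒳) (4 * C₂ * ε ^ 2))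
    (hDfix : ∀ B : 𝒴, ‖B‖ < ε → Ct (B - hop (Dt B)) = Dt B) :
    AnalyticOnNhd ℂ (fun B => Dt B - (2:ℂ)⁻¹ • iteratedFDeriv ℂ 2 Ct 0 (fun _ => B)) (ball (0:𝒴) ε) :=
  fun B₀ hB₀ => (analyticOnNhd_Dt hC hCa hC₂ hb hHop hq hRC hDball hDfix B₀ hB₀).sub
    ((analyticAt_iteratedFDeriv_two_diag Ct 0 B₀).const_smul)

/-- **THIRD ORDER: `D̃₃(B) = D̃(B) − C̃⁽²⁾(B) = O(‖B‖³)` at `B = 0`** («D₃ is the higher order remainder»): the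
Taylor remainder of the analytic `D̃` after its terms of orders `0, 1, 2`, which are `0, 0, C̃⁽²⁾(B)` (§3).
[cite: Balaban1987RG1, pp.266-267] -/
theorem isBigO_Dt3 (hC : QuadAnalytic Ct C₂ R) (hCa : AnalyticOnNhd ℂ Ct {Y : 𝒴 | ‖Y‖ < R})
    (hC₂ : 0 ≤ C₂) (hb : 0 ≤ b) (hHop : ∀ X, ‖hop X‖ ≤ b * ‖X‖) (hq : 9 * C₂ * b * ε < 1)
    (hRC : 3 * ε ≤ R) (hDball : ∀ B : 𝒴, ‖B‖ < ε → Dt B ∈ closedBall (0:𝒳) (4 * C₂ * ε ^ 2))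
    (hDfix : ∀ B : 𝒴, ‖B‖ < ε → Ct (B - hop (Dt B)) = Dt B) (hε : 0 < ε) :
    (fun B => Dt B - (2:ℂ)⁻¹ • iteratedFDeriv ℂ 2 Ct 0 (fun _ => B)) =O[𝓝 (0:𝒴)] fun B => ‖B‖ ^ 3 := by
  obtain ⟨p, hp⟩ := analyticAt_Dt hC hCa hC₂ hb hHop hq hRC hDball hDfix (B₀ := (0:𝒴)) (by simpa using hε)
  have h := hp.isBigO_sub_partialSum_pow 3
  have h01 := coeff_zero_one_Dt hC hCa hC₂ hb hHop hq hRC hDball hDfix hε hp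
  refine h.congr_left fun B => ?_
  rw [zero_add, FormalMultilinearSeries.partialSum]
  simp only [Finset.sum_range_succ, Finset.sum_range_zero, zero_add, h01.1, h01.2,
    zero_apply, add_zero]
  rw [coeff_two_Dt_eq hC hCa hC₂ hb hHop hq hRC hDball hDfix hε hp]

/-- **SCALING LIMIT `g⁻²D̃(gB′) → C̃⁽²⁾(B′)`** (`g → 0`, `g ≠ 0`): after «the scaling transformation B = g_kB′» the
term `hD̃(g_kCB)/g_k²` has the order-zero part `hC̃⁽²⁾(B′)` of (2.11).  From §4: `g⁻²D̃(gB′) − C̃⁽²⁾(B′) =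
g⁻²D̃₃(gB′) = O(g)`. [cite: Balaban1987RG1, p.267 (2.11)] -/
theorem tendsto_scaling (hC : QuadAnalytic Ct C₂ R) (hCa : AnalyticOnNhd ℂ Ct {Y : 𝒴 | ‖Y‖ < R})
    (hC₂ : 0 ≤ C₂) (hb : 0 ≤ b) (hHop : ∀ X, ‖hop X‖ ≤ b * ‖X‖) (hq : 9 * C₂ * b * ε < 1)
    (hRC : 3 * ε ≤ R) (hDball : ∀ B : 𝒴, ‖B‖ < ε → Dt B ∈ closedBall (0:𝒳) (4 * C₂ * ε ^ 2))
    (hDfix : ∀ B : 𝒴, ‖B‖ < ε → Ct (B - hop (Dt B)) = Dt B) (hε : 0 < ε) (B' : 𝒴) :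
    Tendsto (fun g : ℂ => (g ^ 2)⁻¹ • Dt (g • B')) (𝓝[≠] 0)
      (𝓝 ((2:ℂ)⁻¹ • iteratedFDeriv ℂ 2 Ct 0 (fun _ => B'))) := by
  have hFO := isBigO_Dt3 hC hCa hC₂ hb hHop hq hRC hDball hDfix hε
  set Q : 𝒳 := (2:ℂ)⁻¹ • iteratedFDeriv ℂ 2 Ct 0 (fun _ => B') with hQ
  set F : 𝒴 → 𝒳 := fun B => Dt B - (2:ℂ)⁻¹ • iteratedFDeriv ℂ 2 Ct 0 (fun _ => B) with hF
  -- the scaling map `g ↦ gB′` tends to `0`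
  have hk : Tendsto (fun g : ℂ => g • B') (𝓝[≠] 0) (𝓝 0) := by
    have h : Tendsto (fun g : ℂ => g • B') (𝓝 0) (𝓝 ((0:ℂ) • B')) :=
      (continuous_id.smul continuous_const).tendsto 0
    rw [zero_smul] at h
    exact h.mono_left nhdsWithin_le_nhds
  -- `F(gB′) = O(|g|³)`
  have h1 : (F ∘ fun g : ℂ => g • B') =O[𝓝[≠] 0] fun g : ℂ => ‖g‖ ^ 3 := by
    refine (hFO.comp_tendsto hk).trans (IsBigO.of_bound (‖B'‖ ^ 3) (Eventually.of_forall fun g => ?_))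
    simp only [Function.comp_apply, norm_smul, mul_pow]
    rw [Real.norm_of_nonneg (by positivity), Real.norm_of_nonneg (by positivity), mul_comm]
  -- hence `g⁻²F(gB′) = O(|g|) → 0`
  have h2 : (fun g : ℂ => (g ^ 2)⁻¹ • F (g • B')) =O[𝓝[≠] 0] fun g : ℂ => g := by
    obtain ⟨C, hC'⟩ := h1.bound
    refine IsBigO.of_bound C ?_
    filter_upwards [hC', self_mem_nhdsWithin] with g hg hg0
    have hg0' : (0:ℝ) < ‖g‖ := norm_pos_iff.mpr hg0
    rw [Real.norm_of_nonneg (by positivity), Function.comp_apply] at hg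
    rw [norm_smul, norm_inv, norm_pow]
    calc (‖g‖ ^ 2)⁻¹ * ‖F (g • B')‖ ≤ (‖g‖ ^ 2)⁻¹ * (C * ‖g‖ ^ 3) := by gcongr
      _ = C * ‖g‖ := by field_simp
  have h3 : Tendsto (fun g : ℂ => (g ^ 2)⁻¹ • F (g • B')) (𝓝[≠] 0) (𝓝 0) :=
    h2.trans_tendsto (tendsto_nhdsWithin_of_tendsto_nhds tendsto_id)
  -- and `g⁻²D̃(gB′) = g⁻²F(gB′) + Q` for `g ≠ 0`
  have h4 : (fun g : ℂ => (g ^ 2)⁻¹ • Dt (g • B')) =ᶠ[𝓝[≠] 0] fun g => (g ^ 2)⁻¹ • F (g • B') + Q := by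
    filter_upwards [self_mem_nhdsWithin] with g hg0
    have hg2 : g ^ 2 ≠ 0 := pow_ne_zero 2 hg0
    simp only [hF, hQ, iteratedFDeriv_two_smul, smul_sub, smul_smul]
    rw [mul_left_comm, inv_mul_cancel₀ hg2, mul_one, sub_add_cancel]
  rw [tendsto_congr' h4]
  simpa using h3.add_const Q

end thirdorder

/-! ## §5  Transcription for B12 p. 267 -/
section transcription

variable {𝒳 𝒴 : Type*} [NormedAddCommGroup 𝒳] [NormedSpace ℂ 𝒳] [CompleteSpace 𝒳]
  [NormedAddCommGroup 𝒴] [NormedSpace ℂ 𝒴] [CompleteSpace 𝒴]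

/-- **B12 p. 267 «From this equation we obtain also that D̃(B) has an expansion beginning with quadratic terms, and
D̃⁽²⁾(B) = C̃⁽²⁾(B).»** — transcription for the hypothesis-style `D̃` of `B12Lineariz267` /
`B12LinearizAnalytic267` (schematic typing of the module docstring; `9C₂bε < 1`, `3ε ≤ R`, `0 < ε`):
(i) `D̃(0) = 0` and `DD̃(0) = 0` (orders 0 and 1 vanish); (ii) `D̃` has a power-series expansion at `0`, and for every
such expansion `p`: `p 0 = 0`, `p 1 = 0`; (iii) `D²D̃(0) = D²C̃(0)` (`iteratedFDeriv ℂ 2`), and for all expansions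
`p` of `D̃` and `q` of `C̃` at `0`, `p 2 (B, B) = q 2 (B, B)` («D̃⁽²⁾(B) = C̃⁽²⁾(B)»); (iv) the chain-rule form
`DD̃(B₀) = DC̃(Φ(B₀)) ∘ (1 − h∘DD̃(B₀))` of the derivative of the print's equation on the ball; (v) the remainder
`D̃₃ = D̃ − C̃⁽²⁾` is analytic on `‖B‖ < ε` and `O(‖B‖³)` at `0`; (vi) the scaling limit `g⁻²D̃(gB′) → C̃⁽²⁾(B′)`
(`g → 0`, `g ≠ 0`) behind the order-zero term (2.11).  Everything about `D̃`, `C̃`, `h` is a HYPOTHESIS; nothing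
printed is asserted. [cite: Balaban1987RG1, p.267] -/
theorem p267_second_order {hop : 𝒳 →ₗ[ℂ] 𝒴} {Ct : 𝒴 → 𝒳} {C₂ R b ε : ℝ} {Dt : 𝒴 → 𝒳}
    (hC : QuadAnalytic Ct C₂ R) (hCa : AnalyticOnNhd ℂ Ct {Y : 𝒴 | ‖Y‖ < R})
    (hC₂ : 0 ≤ C₂) (hb : 0 ≤ b) (hHop : ∀ X, ‖hop X‖ ≤ b * ‖X‖) (hq : 9 * C₂ * b * ε < 1)
    (hRC : 3 * ε ≤ R) (hDball : ∀ B : 𝒴, ‖B‖ < ε → Dt B ∈ closedBall (0:𝒳) (4 * C₂ * ε ^ 2))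
    (hDfix : ∀ B : 𝒴, ‖B‖ < ε → Ct (B - hop (Dt B)) = Dt B) (hε : 0 < ε) :
    (Dt 0 = 0 ∧ fderiv ℂ Dt 0 = 0) ∧
    ((∃ p : FormalMultilinearSeries ℂ 𝒴 𝒳, HasFPowerSeriesAt Dt p 0) ∧
      ∀ p : FormalMultilinearSeries ℂ 𝒴 𝒳, HasFPowerSeriesAt Dt p 0 → p 0 = 0 ∧ p 1 = 0) ∧
    (iteratedFDeriv ℂ 2 Dt (0:𝒴) = iteratedFDeriv ℂ 2 Ct 0 ∧
      ∀ p q : FormalMultilinearSeries ℂ 𝒴 𝒳, HasFPowerSeriesAt Dt p 0 → HasFPowerSeriesAt Ct q 0 →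
        ∀ B : 𝒴, p 2 (fun _ => B) = q 2 (fun _ => B)) ∧
    (∀ B₀ : 𝒴, ‖B₀‖ < ε →
      fderiv ℂ Dt B₀ = fderiv ℂ Ct (B₀ - hop (Dt B₀)) ∘L (1 - hop.mkContinuous b hHop ∘L fderiv ℂ Dt B₀)) ∧
    (AnalyticOnNhd ℂ (fun B => Dt B - (2:ℂ)⁻¹ • iteratedFDeriv ℂ 2 Ct 0 (fun _ => B)) (ball (0:𝒴) ε) ∧
      (fun B => Dt B - (2:ℂ)⁻¹ • iteratedFDeriv ℂ 2 Ct 0 (fun _ => B)) =O[𝓝 (0:𝒴)] fun B => ‖B‖ ^ 3) ∧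
    (∀ B' : 𝒴, Tendsto (fun g : ℂ => (g ^ 2)⁻¹ • Dt (g • B')) (𝓝[≠] 0)
      (𝓝 ((2:ℂ)⁻¹ • iteratedFDeriv ℂ 2 Ct 0 (fun _ => B')))) :=
  ⟨⟨Dt_zero hC hC₂ hb hHop hq hRC hDball hDfix hε, fderiv_Dt_zero hC hCa hC₂ hb hHop hq hRC hDball hDfix hε⟩,
    ⟨analyticAt_Dt hC hCa hC₂ hb hHop hq hRC hDball hDfix (B₀ := (0:𝒴)) (by simpa using hε),
      fun _ hp => coeff_zero_one_Dt hC hCa hC₂ hb hHop hq hRC hDball hDfix hε hp⟩,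
    ⟨iteratedFDeriv_two_Dt_zero hC hCa hC₂ hb hHop hq hRC hDball hDfix hε,
      fun _ _ hp hq' B => coeff_two_Dt_eq_Ct hC hCa hC₂ hb hHop hq hRC hDball hDfix hε hp hq' B⟩,
    fun _ hB₀ => fderiv_Dt_chain hC hCa hC₂ hb hHop hq hRC hDball hDfix hB₀,
    ⟨analyticOnNhd_Dt3 hC hCa hC₂ hb hHop hq hRC hDball hDfix,
      isBigO_Dt3 hC hCa hC₂ hb hHop hq hRC hDball hDfix hε⟩,
    fun B' => tendsto_scaling hC hCa hC₂ hb hHop hq hRC hDball hDfix hε B'⟩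

/-- Non-vacuity of the hypothesis set: the degenerate model `𝒳 = 𝒴 = ℂ`, `h = id`, `C̃ = 0`, `D̃ = 0`, `C₂ = 0`,
`R = 3`, `b = 1`, `ε = 1` satisfies every hypothesis of `p267_second_order`. -/
example : ∃ (hop : ℂ →ₗ[ℂ] ℂ) (Ct : ℂ → ℂ) (C₂ R b ε : ℝ) (Dt : ℂ → ℂ),
    QuadAnalytic Ct C₂ R ∧ AnalyticOnNhd ℂ Ct {Y : ℂ | ‖Y‖ < R} ∧ 0 ≤ C₂ ∧ 0 ≤ b ∧
    (∀ X, ‖hop X‖ ≤ b * ‖X‖) ∧ 9 * C₂ * b * ε < 1 ∧ 3 * ε ≤ R ∧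
    (∀ B : ℂ, ‖B‖ < ε → Dt B ∈ closedBall (0:ℂ) (4 * C₂ * ε ^ 2)) ∧
    (∀ B : ℂ, ‖B‖ < ε → Ct (B - hop (Dt B)) = Dt B) ∧ 0 < ε := by
  refine ⟨LinearMap.id, fun _ => 0, 0, 3, 1, 1, fun _ => 0, ⟨fun Y _ => by simp, fun P Q => ?_⟩,
    fun Y _ => analyticAt_const, le_rfl, zero_le_one, fun X => by simp, by norm_num, by norm_num,
    fun B _ => by simp, fun B _ => rfl, one_pos⟩
  exact differentiableOn_const 0

end transcription

end Literature.MathematicalPhysics.QuantumFieldTheory.Balaban1983to89.B12SecondOrder267
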